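import Literature.MathematicalPhysics.QuantumLattice.GrassmannGaussianExpectation
import HarnessLib

/-!
# The Gaussian Grassmann integral with sources AND an observable: translation by `GJ`
# (Dimock 2025, §2.3 PROPOSITION 7 — "the key identity for subsequent developments"), finite Berezin form

Topic `Literature/MathematicalPhysics/QuantumLattice`; continues `GrassmannGaussianSources.lean` (the case without
observable: `berezinOn_grassmannExp_quadratic_add_sources`, Salmhofer 1999 Lemma B.6), `GrassmannIntegralPartialShift.lean`
(translation invariance of partial Berezin integration under spectator shifts, `IsSpectatorShift.berezinOn_map`) and
`GrassmannGaussianExpectation.lean` (the block integration `gaussOn`).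

statement-level skeleton of published theorems with citation tags; proofs where landed; nothing here is a claim about the Yang–Mills mass gap

**The printed statement.**  J. Dimock, *Correlation functions for the Gross–Neveu model*, Rev. Math. Phys. **37** (2025)
2450060 (= arXiv:2406.16799v2) [Dimock2025GNCorrelations], §2.3, p.15 L29–45 of the held text layer
`paper:arxiv-2406.16799`: *"Proposition 7. Let `F ∈ 𝒢_h` and `h(G) + ‖G‖h′ < h`. Then in `𝒢_{h′}`
`∫ e^{⟨J̄,ψ⟩+⟨ψ̄,J⟩} F(ψ, ψ̄) dμ_G(ψ) = e^{⟨J̄,GJ⟩} ∫ F(ψ + GJ, ψ̄ + J̄G) dμ_G(ψ)` (83).  Remarks. 1. This is the key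
identity for subsequent developments. Formally the result follows by the change of variables `ψ → ψ + GJ` and
`ψ̄ → ψ̄ + J̄G`. Indeed formally `dμ_G(ψ) = Z⁻¹ exp(−⟨ψ̄,G⁻¹ψ⟩)Dψ` so under the change it generates the object
`−⟨J̄,ψ⟩ − ⟨ψ̄,J⟩ − ⟨J̄,GJ⟩`. The existing `⟨J̄,ψ⟩ + ⟨ψ̄,J⟩` becomes `⟨J̄,ψ⟩ + ⟨ψ̄,J⟩ + 2⟨J̄,GJ⟩`. The two contributions
add to `⟨J̄,GJ⟩`."*  (Used there for Lemma 1 (107)–(111) and Lemma 2 (114)–(116).)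

**What is formalised (finite index sets; Berezin form with spectators; kernel-checked, no `sorry`, no named facts).**
The fermions `ψ̄ᵢ = θ_{e(inl i)}`, `ψᵢ = θ_{e(inr i)}` of a block placed by `e : ι ⊕ₗ ι ↪o J` are integrated with the weight
`e^{ψ̄Aψ}` (`gaussOn R e A`, un-normalised: `gaussOn R e A 1 = ε det A`, `ε = (−1)^{n(n−1)∕2}`); the sources
`J̄ᵢ = ι(v̄ᵢ)`, `Jᵢ = ι(vᵢ)` are degree-one elements supported OUTSIDE the block (Grassmann-valued sources, as in the
paper); `G` is Dimock's covariance, tied to the weight by `A G = −1` (`G = −A⁻¹`, `∫ ψᵢψ̄ⱼ dμ_G = Gᵢⱼ`, cf.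
`GrassmannBerezinLaplacianBridge.twoSpeciesCov`).
* `sourceShift R e G v̄ v` — the endomorphism `N_G` of the generator space with `1 + N_G` = the substitution
  `ψⱼ ↦ ψⱼ + (GJ)ⱼ`, `ψ̄ᵢ ↦ ψ̄ᵢ + (J̄G)ᵢ`, spectators fixed (`map_one_add_sourceShift_psi ∕ _psiBar`); it is a spectator
  shift (`isSpectatorShift_sourceShift`) with `N_G² = 0` (`sourceShift_comp_sourceShift`), so `1 − N_G` inverts it.
* **`map_one_sub_sourceShift_quadratic`** — completing the square: `(ψ̄Aψ) ∘ (1 − N_G) = ψ̄Aψ + (⟨J̄,ψ⟩ + ⟨ψ̄,J⟩) − ⟨J̄,GJ⟩`.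
* **`berezinOn_grassmannExp_quadratic_mul_grassmannExp_sources_mul`** — PROPOSITION 7 in Berezin form: for every `X`,
  `∫dθ_s e_*(e^{ψ̄Aψ}) e^{⟨J̄,ψ⟩+⟨ψ̄,J⟩} X = (∫dθ_s e_*(e^{ψ̄Aψ}) · (X ∘ (1 + N_G))) · e^{⟨J̄,GJ⟩}`.
* **`gaussOn_grassmannExp_sources_mul`** — the same for `gaussOn`:
  `gaussOn R e A (e^{⟨J̄,ψ⟩+⟨ψ̄,J⟩} X) = gaussOn R e A (X ∘ (1 + N_G)) · e^{⟨J̄,GJ⟩}`; with `X = 1` this is the tree's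
  generating functional `gaussOn_grassmannExp_sources` (re-derived as `gaussOn_grassmannExp_sources_of_mul`).

**Scope.**  Finite-dimensional identity only (the paper's `𝒢_h` norms, `h(G) + ‖G‖h′ < h`, and the torus are not
modelled); `R` any commutative `ℚ`-algebra; `A G = −1` replaces the invertibility of `A`.
-/

noncomputable section

namespace Literature.MathematicalPhysics.QuantumLattice

section QLatticeAQFT

namespace GrassmannAlgebra

open ExteriorAlgebra

variable (R : Type*) [CommRing R] {ι : Type*} [LinearOrder ι] [Fintype ι] {J : Type*} [LinearOrder J]

/-- **The source shift** `N_G`: the endomorphism of the generator space `J → R` sending the generator `ψⱼ = θ_{e(inr j)}` to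
`Σ_l G_{jl} v_l` (the coefficient vector of `(GJ)ⱼ`), `ψ̄ᵢ = θ_{e(inl i)}` to `Σ_k G_{ki} v̄_k` (that of `(J̄G)ᵢ`), so that the
substitution `1 + N_G` is Dimock's change of variables `ψ → ψ + GJ`, `ψ̄ → ψ̄ + J̄G`.
[cite: Dimock2025GNCorrelations, §2.3 Proposition 7 Remark 1 p.15 L37–42] -/
def sourceShift (e : ι ⊕ₗ ι ↪o J) (G : Matrix ι ι R) (vbar v : ι → J → R) : Module.End R (J → R) :=
  ∑ j, (LinearMap.proj (e (toLex (Sum.inr j)))).smulRight (∑ l, G j l • v l) +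
    ∑ i, (LinearMap.proj (e (toLex (Sum.inl i)))).smulRight (∑ k, G k i • vbar k)

variable (e : ι ⊕ₗ ι ↪o J) (G : Matrix ι ι R) (vbar v : ι → J → R)

/-- Unfolding `sourceShift`. [cite: Dimock2025GNCorrelations, §2.3 Proposition 7 Remark 1 p.15 L37–42] -/
theorem sourceShift_apply (w : J → R) :
    sourceShift R e G vbar v w = ∑ j, w (e (toLex (Sum.inr j))) • (∑ l, G j l • v l) +
      ∑ i, w (e (toLex (Sum.inl i))) • (∑ k, G k i • vbar k) := by
  simp only [sourceShift, LinearMap.add_apply, LinearMap.sum_apply, LinearMap.smulRight_apply, LinearMap.proj_apply]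

/-- `N_{−G} = −N_G`. [cite: Dimock2025GNCorrelations, §2.3 Proposition 7 Remark 1 p.15 L37–42] -/
theorem sourceShift_neg : sourceShift R e (-G) vbar v = -sourceShift R e G vbar v :=
  LinearMap.ext fun w => by
    simp only [sourceShift_apply, LinearMap.neg_apply, Matrix.neg_apply, neg_smul, Finset.sum_neg_distrib, smul_neg,
      neg_add]

variable {vbar v} (hvbar : ∀ i k, vbar i (e k) = 0) (hv : ∀ i k, v i (e k) = 0)
include hvbar hv

/-- The shift vectors vanish on the block. [cite: Dimock2025GNCorrelations, §2.3 Proposition 7 Remark 1 p.15 L37–42] -/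
theorem sourceShift_apply_apply (w : J → R) (k : ι ⊕ₗ ι) : sourceShift R e G vbar v w (e k) = 0 := by
  simp only [sourceShift_apply, Pi.add_apply, Finset.sum_apply, Pi.smul_apply, hv, hvbar, smul_zero,
    Finset.sum_const_zero, add_zero]

/-- `N_G` is a spectator shift of the block `s = e(ι ⊕ₗ ι)` (kills spectator generators, maps block generators into the
spectators). [cite: Dimock2025GNCorrelations, §2.3 Proposition 7 Remark 1 p.15 L37–42] -/
theorem isSpectatorShift_sourceShift :
    IsSpectatorShift R (Finset.univ.map e.toEmbedding) (sourceShift R e G vbar v) := by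
  refine ⟨fun x hx => ?_, fun y x hx => ?_⟩
  · rw [sourceShift_apply]
    have hx' : ∀ k, e k ≠ x := fun k h => hx (by
      rw [Finset.mem_map]; exact ⟨k, Finset.mem_univ _, h⟩)
    have h1 : ∀ k, (Pi.single x (1 : R) : J → R) (e k) = 0 := fun k => Pi.single_eq_of_ne (hx' k) _
    simp only [h1, zero_smul, Finset.sum_const_zero, add_zero]
  · obtain ⟨k, -, rfl⟩ := Finset.mem_map.1 hx
    exact sourceShift_apply_apply R e G hvbar hv _ k

/-- `N_G² = 0` (the shift vectors are spectators, which `N_G` kills). [cite: Dimock2025GNCorrelations, §2.3 Proposition 7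
Remark 1 p.15 L37–42] -/
theorem sourceShift_comp_sourceShift : sourceShift R e G vbar v * sourceShift R e G vbar v = 0 := by
  refine LinearMap.ext fun w => ?_
  rw [Module.End.mul_apply, LinearMap.zero_apply, sourceShift_apply R e G vbar v (sourceShift R e G vbar v w)]
  simp only [sourceShift_apply_apply R e G hvbar hv, zero_smul, Finset.sum_const_zero, add_zero]

/-- `(1 − N_G)(1 + N_G) = 1`. [cite: Dimock2025GNCorrelations, §2.3 Proposition 7 Remark 1 p.15 L37–42] -/
theorem one_sub_sourceShift_mul_one_add :
    (1 - sourceShift R e G vbar v) * (1 + sourceShift R e G vbar v) = 1 := by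
  rw [mul_add, sub_mul, sub_mul, one_mul, one_mul, mul_one, sourceShift_comp_sourceShift R e G hvbar hv, sub_zero,
    sub_add_cancel]

/-- The inverse substitution undoes the shift: `(X ∘ (1 + N_G)) ∘ (1 − N_G) = X`.
[cite: Dimock2025GNCorrelations, §2.3 Proposition 7 Remark 1 p.15 L37–42] -/
theorem map_one_sub_sourceShift_map_one_add (X : GrassmannAlgebra R J) :
    ExteriorAlgebra.map (1 - sourceShift R e G vbar v) (ExteriorAlgebra.map (1 + sourceShift R e G vbar v) X) = X := by
  rw [← AlgHom.comp_apply, ExteriorAlgebra.map_comp_map, ← Module.End.mul_eq_comp,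
    one_sub_sourceShift_mul_one_add R e G hvbar hv, Module.End.one_eq_id, ExteriorAlgebra.map_id, AlgHom.id_apply]

omit hvbar hv in
/-- The substitution on `ψⱼ`: `ψⱼ ↦ ψⱼ + Σ_l G_{jl} J_l`. [cite: Dimock2025GNCorrelations, §2.3 Proposition 7 (83) p.15 L29–36] -/
theorem map_one_add_sourceShift_psi (j : ι) :
    ExteriorAlgebra.map (1 + sourceShift R e G vbar v) (gen R (e (toLex (Sum.inr j)))) =
      gen R (e (toLex (Sum.inr j))) + ∑ l, G j l • ExteriorAlgebra.ι R (v l) := by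
  have hinj' : ∀ a b : ι ⊕ₗ ι, (e a = e b) = (a = b) := fun a b => propext e.injective.eq_iff
  rw [map_one_add_gen, sourceShift_apply]
  have h1 : ∀ i, (Pi.single (e (toLex (Sum.inr j))) (1 : R) : J → R) (e (toLex (Sum.inl i))) = 0 :=
    fun i => Pi.single_eq_of_ne (fun h => by cases e.injective h) _
  have h2 : ∀ j', (Pi.single (e (toLex (Sum.inr j))) (1 : R) : J → R) (e (toLex (Sum.inr j'))) =
      if j' = j then 1 else 0 := fun j' => by simp only [Pi.single_apply, hinj', toLex_inj, Sum.inr.injEq]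
  simp only [h1, h2, zero_smul, Finset.sum_const_zero, add_zero, ite_smul, one_smul, zero_smul, Finset.sum_ite_eq',
    Finset.mem_univ, if_true, map_sum, map_smul]

omit hvbar hv in
/-- The substitution on `ψ̄ᵢ`: `ψ̄ᵢ ↦ ψ̄ᵢ + Σ_k J̄_k G_{ki}`. [cite: Dimock2025GNCorrelations, §2.3 Proposition 7 (83) p.15 L29–36] -/
theorem map_one_add_sourceShift_psiBar (i : ι) :
    ExteriorAlgebra.map (1 + sourceShift R e G vbar v) (gen R (e (toLex (Sum.inl i)))) =
      gen R (e (toLex (Sum.inl i))) + ∑ k, G k i • ExteriorAlgebra.ι R (vbar k) := by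
  have hinj' : ∀ a b : ι ⊕ₗ ι, (e a = e b) = (a = b) := fun a b => propext e.injective.eq_iff
  rw [map_one_add_gen, sourceShift_apply]
  have h1 : ∀ j, (Pi.single (e (toLex (Sum.inl i))) (1 : R) : J → R) (e (toLex (Sum.inr j))) = 0 :=
    fun j => Pi.single_eq_of_ne (fun h => by cases e.injective h) _
  have h2 : ∀ i', (Pi.single (e (toLex (Sum.inl i))) (1 : R) : J → R) (e (toLex (Sum.inl i'))) =
      if i' = i then 1 else 0 := fun i' => by simp only [Pi.single_apply, hinj', toLex_inj, Sum.inl.injEq]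
  simp only [h1, h2, zero_smul, Finset.sum_const_zero, zero_add, ite_smul, one_smul, zero_smul, Finset.sum_ite_eq',
    Finset.mem_univ, if_true, map_sum, map_smul]

omit hvbar hv in
/-- The inverse substitution on `ψⱼ`: `ψⱼ ↦ ψⱼ − Σ_l G_{jl} J_l`. [cite: Dimock2025GNCorrelations, §2.3 Proposition 7 (83) p.15 L29–36] -/
theorem map_one_sub_sourceShift_psi (j : ι) :
    ExteriorAlgebra.map (1 - sourceShift R e G vbar v) (gen R (e (toLex (Sum.inr j)))) =
      gen R (e (toLex (Sum.inr j))) - ∑ l, G j l • ExteriorAlgebra.ι R (v l) := by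
  have h := map_one_add_sourceShift_psi R e (-G) (vbar := vbar) (v := v) j
  rw [sourceShift_neg, ← sub_eq_add_neg] at h
  rw [h, sub_eq_add_neg, ← Finset.sum_neg_distrib]
  simp only [Matrix.neg_apply, neg_smul]

omit hvbar hv in
/-- The inverse substitution on `ψ̄ᵢ`: `ψ̄ᵢ ↦ ψ̄ᵢ − Σ_k J̄_k G_{ki}`. [cite: Dimock2025GNCorrelations, §2.3 Proposition 7 (83) p.15 L29–36] -/
theorem map_one_sub_sourceShift_psiBar (i : ι) :
    ExteriorAlgebra.map (1 - sourceShift R e G vbar v) (gen R (e (toLex (Sum.inl i)))) =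
      gen R (e (toLex (Sum.inl i))) - ∑ k, G k i • ExteriorAlgebra.ι R (vbar k) := by
  have h := map_one_add_sourceShift_psiBar R e (-G) (vbar := vbar) (v := v) i
  rw [sourceShift_neg, ← sub_eq_add_neg] at h
  rw [h, sub_eq_add_neg, ← Finset.sum_neg_distrib]
  simp only [Matrix.neg_apply, neg_smul]

variable [Algebra ℚ R] {A : Matrix ι ι R} (hAG : A * G = -1)
include hAG

omit hvbar hv [Algebra ℚ R] in
/-- **Completing the square** (Remark 1 of the paper, with the tree's weight `e^{+ψ̄Aψ}`, `A G = −1`):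
`(ψ̄Aψ) ∘ (1 − N_G) = ψ̄Aψ + Σᵢ(J̄ᵢψᵢ + ψ̄ᵢJᵢ) − Σᵢⱼ Gᵢⱼ J̄ᵢJⱼ` — expand `(ψ̄ − J̄G)A(ψ − GJ)` and use `AG = GA = −1`.
[cite: Dimock2025GNCorrelations, §2.3 Proposition 7 Remark 1 p.15 L37–42] -/
theorem map_one_sub_sourceShift_quadratic :
    ExteriorAlgebra.map (1 - sourceShift R e G vbar v)
        (ExteriorAlgebra.map (Function.ExtendByZero.linearMap R e) (quadratic R A)) =
      ExteriorAlgebra.map (Function.ExtendByZero.linearMap R e) (quadratic R A) +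
        ∑ i, (ExteriorAlgebra.ι R (vbar i) * gen R (e (toLex (Sum.inr i))) +
          gen R (e (toLex (Sum.inl i))) * ExteriorAlgebra.ι R (v i)) -
        ∑ i, ∑ j, G i j • (ExteriorAlgebra.ι R (vbar i) * ExteriorAlgebra.ι R (v j)) := by
  -- notation
  set Pb : ι → GrassmannAlgebra R J := fun i => gen R (e (toLex (Sum.inl i))) with hPb
  set P : ι → GrassmannAlgebra R J := fun j => gen R (e (toLex (Sum.inr j))) with hP
  set Bb : ι → GrassmannAlgebra R J := fun i => ExteriorAlgebra.ι R (vbar i) with hBb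
  set B : ι → GrassmannAlgebra R J := fun j => ExteriorAlgebra.ι R (v j) with hB
  have hGA : G * A = -1 := by
    have h : A * (-G) = 1 := by rw [Matrix.mul_neg, hAG, neg_neg]
    have h' : (-G) * A = 1 := mul_eq_one_comm.mp h
    rwa [Matrix.neg_mul, neg_eq_iff_eq_neg] at h'
  have hQ₀sum : ExteriorAlgebra.map (Function.ExtendByZero.linearMap R e) (quadratic R A) =
      ∑ i, ∑ j, A i j • (Pb i * P j) := by
    simp only [quadratic, map_sum, map_smul, map_mul, hPb, hP, psiBar, psi, map_extendByZero_gen']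
  have hmapP : ∀ j, ExteriorAlgebra.map (1 - sourceShift R e G vbar v) (P j) = P j - ∑ l, G j l • B l :=
    fun j => map_one_sub_sourceShift_psi R e G j
  have hmapPb : ∀ i, ExteriorAlgebra.map (1 - sourceShift R e G vbar v) (Pb i) = Pb i - ∑ k, G k i • Bb k :=
    fun i => map_one_sub_sourceShift_psiBar R e G i
  have hAG' : ∀ i l, ∑ j, A i j * G j l = -(if i = l then 1 else 0) := by
    intro i l
    rw [← Matrix.mul_apply, hAG, Matrix.neg_apply, Matrix.one_apply]
  have hGA' : ∀ k j, ∑ i, G k i * A i j = -(if k = j then 1 else 0) := by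
    intro k j
    rw [← Matrix.mul_apply, hGA, Matrix.neg_apply, Matrix.one_apply]
  have hc1 : ∀ i, ∑ j, A i j • (∑ l, G j l • B l) = -B i := by
    intro i
    simp only [Finset.smul_sum, smul_smul]
    rw [Finset.sum_comm]
    simp only [← Finset.sum_smul, hAG', neg_smul, ite_smul, one_smul, zero_smul, Finset.sum_neg_distrib,
      Finset.sum_ite_eq, Finset.mem_univ, if_true]
  have hc2 : ∀ j, ∑ i, A i j • (∑ k, G k i • Bb k) = -Bb j := by
    intro j
    simp only [Finset.smul_sum, smul_smul]
    rw [Finset.sum_comm]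
    simp only [← Finset.sum_smul, mul_comm (A _ j), hGA', neg_smul, ite_smul, one_smul, zero_smul,
      Finset.sum_neg_distrib, Finset.sum_ite_eq', Finset.mem_univ, if_true]
  rw [hQ₀sum]
  simp only [map_sum, map_smul, map_mul, hmapP, hmapPb]
  simp only [sub_mul, mul_sub, smul_sub, Finset.sum_sub_distrib]
  have e1 : ∑ i, ∑ j, A i j • (Pb i * ∑ l, G j l • B l) = -∑ i, Pb i * B i := by
    rw [← Finset.sum_neg_distrib]
    refine Finset.sum_congr rfl fun i _ => ?_
    rw [← mul_neg, ← hc1 i, Finset.mul_sum]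
    refine Finset.sum_congr rfl fun j _ => ?_
    rw [mul_smul_comm]
  have e2 : ∑ i, ∑ j, A i j • ((∑ k, G k i • Bb k) * P j) = -∑ j, Bb j * P j := by
    rw [Finset.sum_comm, ← Finset.sum_neg_distrib]
    refine Finset.sum_congr rfl fun j _ => ?_
    rw [← neg_mul, ← hc2 j, Finset.sum_mul]
    refine Finset.sum_congr rfl fun i _ => ?_
    rw [smul_mul_assoc]
  have e3 : ∑ i, ∑ j, A i j • ((∑ k, G k i • Bb k) * ∑ l, G j l • B l) =
      -∑ i, ∑ j, G i j • (Bb i * B j) := by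
    rw [Finset.sum_comm]
    have : ∀ j, ∑ i, A i j • ((∑ k, G k i • Bb k) * ∑ l, G j l • B l) = -(Bb j * ∑ l, G j l • B l) := by
      intro j
      rw [← neg_mul, ← hc2 j, Finset.sum_mul]
      refine Finset.sum_congr rfl fun i _ => ?_
      rw [smul_mul_assoc]
    rw [Finset.sum_congr rfl fun j _ => this j, Finset.sum_neg_distrib]
    simp only [Finset.mul_sum, mul_smul_comm]
  rw [e1, e2, e3, Finset.sum_add_distrib]
  abel

variable [Fintype J]

/-- **Dimock 2025, PROPOSITION 7 (83), in finite Berezin form with spectators**: for every observable `X` of the big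
algebra, with `S = Σᵢ(J̄ᵢψᵢ + ψ̄ᵢJᵢ)`, `T = Σᵢⱼ Gᵢⱼ J̄ᵢJⱼ` and the substitution `σ = 1 + N_G` (`ψ ↦ ψ + GJ`,
`ψ̄ ↦ ψ̄ + J̄G`),

  `∫dθ_s e_*(e^{ψ̄Aψ}) · e^{S} · X = (∫dθ_s e_*(e^{ψ̄Aψ}) · (X ∘ σ)) · e^{T}`.

Proof as in Remark 1: `e^{Q}e^{S} = (e^{Q} ∘ σ⁻¹)·e^{T}` by completing the square (`σ⁻¹ = 1 − N_G`),
`X = (X ∘ σ) ∘ σ⁻¹`, translation invariance of `∫dθ_s` under the spectator shift `σ⁻¹`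
(`IsSpectatorShift.berezinOn_map`), and `e^{T}` is a central spectator. [cite: Dimock2025GNCorrelations, §2.3
Proposition 7 (83) p.15 L29–45] -/
theorem berezinOn_grassmannExp_quadratic_mul_grassmannExp_sources_mul (X : GrassmannAlgebra R J) :
    berezinOn R (Finset.univ.map e.toEmbedding)
        (ExteriorAlgebra.map (Function.ExtendByZero.linearMap R e) (grassmannExp (quadratic R A)) *
          grassmannExp (∑ i, (ExteriorAlgebra.ι R (vbar i) * gen R (e (toLex (Sum.inr i))) +
            gen R (e (toLex (Sum.inl i))) * ExteriorAlgebra.ι R (v i))) * X) =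
      berezinOn R (Finset.univ.map e.toEmbedding)
        (ExteriorAlgebra.map (Function.ExtendByZero.linearMap R e) (grassmannExp (quadratic R A)) *
          ExteriorAlgebra.map (1 + sourceShift R e G vbar v) X) *
        grassmannExp (∑ i, ∑ j, G i j • (ExteriorAlgebra.ι R (vbar i) * ExteriorAlgebra.ι R (v j))) := by
  have hmems : ∀ {x}, x ∈ Finset.univ.map e.toEmbedding ↔ ∃ k, e k = x := by
    intro x
    simp only [Finset.mem_map, Finset.mem_univ, true_and, RelEmbedding.coe_toEmbedding]
  have hshift : IsSpectatorShift R (Finset.univ.map e.toEmbedding) (-sourceShift R e G vbar v) := by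
    have h := isSpectatorShift_sourceShift R e G hvbar hv
    exact ⟨fun x hx => by rw [LinearMap.neg_apply, h.apply_single_of_not_mem x hx, neg_zero],
      fun y x hx => by rw [LinearMap.neg_apply, Pi.neg_apply, h.apply_single_apply_of_mem y x hx, neg_zero]⟩
  -- nilpotency and commutation bookkeeping
  have hnQ : IsNilpotent (quadratic R A) := isNilpotent_quadratic R A
  have hnQ₀ : IsNilpotent (ExteriorAlgebra.map (Function.ExtendByZero.linearMap R e) (quadratic R A)) := hnQ.map _
  have hnQ₀' : IsNilpotent (ExteriorAlgebra.map (1 - sourceShift R e G vbar v)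
      (ExteriorAlgebra.map (Function.ExtendByZero.linearMap R e) (quadratic R A))) := hnQ₀.map _
  have hcT : ∀ z, Commute (∑ i, ∑ j, G i j • (ExteriorAlgebra.ι R (vbar i) * ExteriorAlgebra.ι R (v j))) z :=
    commute_sum_sum_smul_ι_mul_ι G vbar v
  have hnT : IsNilpotent (∑ i, ∑ j, G i j • (ExteriorAlgebra.ι R (vbar i) * ExteriorAlgebra.ι R (v j))) :=
    isNilpotent_sum_sum_smul_ι_mul_ι G vbar v
  have hnS : IsNilpotent (∑ i, (ExteriorAlgebra.ι R (vbar i) * gen R (e (toLex (Sum.inr i))) +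
      gen R (e (toLex (Sum.inl i))) * ExteriorAlgebra.ι R (v i))) := by
    refine Commute.isNilpotent_sum (fun i _ => ?_) fun i j _ _ => ?_
    · refine Commute.isNilpotent_add ?_ ⟨2, ?_⟩ ⟨2, ?_⟩
      · exact commute_ι_mul_ι _ _ _
      · rw [pow_two]; exact ι_mul_ι_mul_self _ _
      · rw [pow_two]; exact ι_mul_ι_mul_self _ _
    · exact Commute.add_left (commute_ι_mul_ι _ _ _) (commute_ι_mul_ι _ _ _)
  have hc : Commute (ExteriorAlgebra.map (Function.ExtendByZero.linearMap R e) (quadratic R A))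
      (∑ i, (ExteriorAlgebra.ι R (vbar i) * gen R (e (toLex (Sum.inr i))) +
        gen R (e (toLex (Sum.inl i))) * ExteriorAlgebra.ι R (v i))) :=
    commute_map_quadratic R _ A (fun x y z => by
      rw [gen, gen, ExteriorAlgebra.map_apply_ι, ExteriorAlgebra.map_apply_ι]
      exact commute_ι_mul_ι _ _ z) _
  -- completing the square, exponentiated: `e^{Q₀} e^{S} = (e^{Q₀} ∘ (1 − N)) · e^{T}`
  have hsquare' : ExteriorAlgebra.map (Function.ExtendByZero.linearMap R e) (quadratic R A) +
      ∑ i, (ExteriorAlgebra.ι R (vbar i) * gen R (e (toLex (Sum.inr i))) +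
        gen R (e (toLex (Sum.inl i))) * ExteriorAlgebra.ι R (v i)) =
      ExteriorAlgebra.map (1 - sourceShift R e G vbar v)
        (ExteriorAlgebra.map (Function.ExtendByZero.linearMap R e) (quadratic R A)) +
      ∑ i, ∑ j, G i j • (ExteriorAlgebra.ι R (vbar i) * ExteriorAlgebra.ι R (v j)) := by
    rw [map_one_sub_sourceShift_quadratic R e G hAG]; abel
  have hexp : ExteriorAlgebra.map (Function.ExtendByZero.linearMap R e) (grassmannExp (quadratic R A)) *
      grassmannExp (∑ i, (ExteriorAlgebra.ι R (vbar i) * gen R (e (toLex (Sum.inr i))) +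
        gen R (e (toLex (Sum.inl i))) * ExteriorAlgebra.ι R (v i))) =
      ExteriorAlgebra.map (1 - sourceShift R e G vbar v)
        (ExteriorAlgebra.map (Function.ExtendByZero.linearMap R e) (grassmannExp (quadratic R A))) *
      grassmannExp (∑ i, ∑ j, G i j • (ExteriorAlgebra.ι R (vbar i) * ExteriorAlgebra.ι R (v j))) := by
    simp only [grassmannExp]
    rw [IsNilpotent.map_exp hnQ (ExteriorAlgebra.map (Function.ExtendByZero.linearMap R e)),
      IsNilpotent.map_exp hnQ₀ (ExteriorAlgebra.map (1 - sourceShift R e G vbar v)),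
      ← IsNilpotent.exp_add_of_commute hc hnQ₀ hnS, hsquare',
      ← IsNilpotent.exp_add_of_commute ((hcT _).symm) hnQ₀' hnT]
  -- the spectator `e^{T}`
  have hspecT : (∑ i, ∑ j, G i j • (ExteriorAlgebra.ι R (vbar i) * ExteriorAlgebra.ι R (v j))) ∈
      spectatorSubalgebra R (Finset.univ.map e.toEmbedding) := by
    refine Subalgebra.sum_mem _ fun i _ => Subalgebra.sum_mem _ fun j _ =>
      Subalgebra.smul_mem _ (Subalgebra.mul_mem _ ?_ ?_) _
    · exact ι_mem_spectatorSubalgebra R fun x hx => by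
        obtain ⟨k, rfl⟩ := hmems.1 hx; exact hvbar i k
    · exact ι_mem_spectatorSubalgebra R fun x hx => by
        obtain ⟨k, rfl⟩ := hmems.1 hx; exact hv j k
  have hspecE : grassmannExp (∑ i, ∑ j, G i j • (ExteriorAlgebra.ι R (vbar i) * ExteriorAlgebra.ι R (v j))) ∈
      spectatorSubalgebra R (Finset.univ.map e.toEmbedding) := exp_mem_of_mem hspecT hnT
  have hcE : ∀ z, Commute (grassmannExp (∑ i, ∑ j, G i j • (ExteriorAlgebra.ι R (vbar i) * ExteriorAlgebra.ι R (v j)))) z :=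
    commute_exp_of_forall_commute hcT hnT
  -- move everything under the inverse substitution `1 − N`
  have h1 : ExteriorAlgebra.map (Function.ExtendByZero.linearMap R e) (grassmannExp (quadratic R A)) *
      grassmannExp (∑ i, (ExteriorAlgebra.ι R (vbar i) * gen R (e (toLex (Sum.inr i))) +
        gen R (e (toLex (Sum.inl i))) * ExteriorAlgebra.ι R (v i))) * X =
      ExteriorAlgebra.map (1 - sourceShift R e G vbar v)
        (ExteriorAlgebra.map (Function.ExtendByZero.linearMap R e) (grassmannExp (quadratic R A)) *
          ExteriorAlgebra.map (1 + sourceShift R e G vbar v) X) *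
      grassmannExp (∑ i, ∑ j, G i j • (ExteriorAlgebra.ι R (vbar i) * ExteriorAlgebra.ι R (v j))) := by
    rw [map_mul, map_one_sub_sourceShift_map_one_add R e G hvbar hv X, hexp, mul_assoc, (hcE X).eq, ← mul_assoc]
  have hsub : (1 : Module.End R (J → R)) - sourceShift R e G vbar v = 1 + -sourceShift R e G vbar v :=
    sub_eq_add_neg _ _
  rw [h1, berezinOn_mul_of_mem_spectatorSubalgebra_of_commute R hspecE hcE, hsub, hshift.berezinOn_map R]

/-- **PROPOSITION 7 (83) for the block integration `gaussOn`** (un-normalised `∫(·)dμ_G` with spectators):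
`gaussOn R e A (e^{Σ(J̄ᵢψᵢ+ψ̄ᵢJᵢ)} · X) = gaussOn R e A (X ∘ σ) · e^{Σ Gᵢⱼ J̄ᵢJⱼ}`, `σ = 1 + N_G` = *"`ψ → ψ + GJ`,
`ψ̄ → ψ̄ + J̄G`"*, `A G = −1`. [cite: Dimock2025GNCorrelations, §2.3 Proposition 7 (83) p.15 L29–45] -/
theorem gaussOn_grassmannExp_sources_mul (X : GrassmannAlgebra R J) :
    gaussOn R e A (grassmannExp (∑ i, (ExteriorAlgebra.ι R (vbar i) * gen R (e (toLex (Sum.inr i))) +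
        gen R (e (toLex (Sum.inl i))) * ExteriorAlgebra.ι R (v i))) * X) =
      gaussOn R e A (ExteriorAlgebra.map (1 + sourceShift R e G vbar v) X) *
        grassmannExp (∑ i, ∑ j, G i j • (ExteriorAlgebra.ι R (vbar i) * ExteriorAlgebra.ι R (v j))) := by
  rw [gaussOn_apply, gaussOn_apply, ← mul_assoc]
  exact berezinOn_grassmannExp_quadratic_mul_grassmannExp_sources_mul R e G hvbar hv hAG X

/-- **The generating functional recovered** (`X = 1`): `gaussOn R e A (e^{Σ(J̄ᵢψᵢ+ψ̄ᵢJᵢ)}) = (ε det A) • e^{Σ Gᵢⱼ J̄ᵢJⱼ}`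
— Dimock's PROPOSITION 5 (67) `∫ e^{⟨J̄,ψ⟩+⟨ψ̄,J⟩}dμ_G = e^{⟨J̄,GJ⟩}` with the normalisation explicit; agrees with the
tree's `gaussOn_grassmannExp_sources` (there `−A⁻¹` for `G`). [cite: Dimock2025GNCorrelations, §2.3 Proposition 5 (67)
p.13 L42–43] -/
theorem gaussOn_grassmannExp_sources_of_mul :
    gaussOn R e A (grassmannExp (∑ i, (ExteriorAlgebra.ι R (vbar i) * gen R (e (toLex (Sum.inr i))) +
        gen R (e (toLex (Sum.inl i))) * ExteriorAlgebra.ι R (v i)))) =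
      ((-1 : R) ^ (Fintype.card ι * (Fintype.card ι - 1) / 2) * A.det) •
        grassmannExp (∑ i, ∑ j, G i j • (ExteriorAlgebra.ι R (vbar i) * ExteriorAlgebra.ι R (v j))) := by
  have h := gaussOn_grassmannExp_sources_mul R e G hvbar hv hAG 1
  rwa [mul_one, map_one, gaussOn_one, Algebra.algebraMap_eq_smul_one, smul_mul_assoc, one_mul] at h

end GrassmannAlgebra

end QLatticeAQFT

end Literature.MathematicalPhysics.QuantumLattice

end
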